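import Summits.QuantumFields.YangMills.Theorems.FluctuationComparisonRegPrIntLS2BetaTildePlaquetteComparison
import Summits.QuantumFields.YangMills.Theorems.FluctuationComparisonRegPrIntLS2BetaLiftLadderCombRowTower
import Summits.QuantumFields.YangMills.Theorems.FluctuationComparisonRegPrIntLS2BetaRelativeStokes
import HarnessLib

/-!
# S2β · THE SUP CHAIN ∕ (D-stage): THE ρ̃ LETTER OF px20's `discRow'` FROM REGION LETTERS — the relative-plaquette hypothesis `hρ` of the tower
# discrepancy row, at the EXPLICIT `ρt t B := ρS t B + ρA t B + 2·(4·sU t + aU t)·mA t B + 2·(4·sA t + aA t)·mA t B`, by ✓p832842 per region plaquette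

Cell `ym3-torus` (rung R3 = continuum `SU(2)` Yang–Mills on T³ at fixed lattice data — NOT d = 4, NOT infinite volume, NOT a mass gap, NOT Clay).  Width seat «width 12»
`ym3-torus-px12` (gen 26), FREE px helper on crux `stmt-QuantumFields-20520`; `--supports` helper, count-neutral, DEFINITION-FREE (0 `def`∕`instance`∕`notation`∕`sorry`,
default heartbeats).

WHY (architect px17 g22 22:05:54Z: px21 g25's (α) `hX′` ASSEMBLER takes the ρ̃ column «`hρ̃ : …` in px12 (d) ✓p832842's currency» as a NAMED budget hypothesis;
px20 g24's `discRow'` (2553b04f) carries the per-plaquette letter `hρ : ∀ t ht B q, ⟨region⟩ → dist1 ((plaqHol W̃ q)⁻¹ * plaqHol W q) ≤ ρt t B` with `ρt` FREE).  This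
file is the (d)-lineage twin of px16's γ `hκrel_of_regionLetters`: it DISCHARGES `hρ` — conclusion = that binder's TEXT VERBATIM (region clause copied, not used) — at
an explicit `ρt` assembled from three REGION letters and four per-level size classes, by the (d) comparison ✓p832842 `dist1_plaqHol_tilde_rel_le` applied once per
region plaquette (`hcomm` discharged for `SU(2)` by ✓`dist1_comm_le_SU`).  Objects (`s = K−(J+(t+1))`): `U = g₀_s • Ū^s U₁`, `W = g_s • Ū^s(e^ζU₀)` (the gauged stage
pair), `A_U = lift s (g₀_{s+1} • Ū^{s+1} U₁)`, `A_W = lift s (g_{s+1} • Ū^{s+1}(e^ζU₀))` (the hat lifts of the parents), `W̃ = A_W·(A_U⁻¹·U)`.  COLUMNS: `ρS` — relative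
STAGE plaquettes `dist1 ((plaqHol U q)⁻¹ * plaqHol W q)` on the region (px10's CELL-MASS ∕ px16's ρP class, a (k1)-type column); `ρA` — relative LIFT plaquettes
`dist1 (plaqHol A_W q * (plaqHol A_U q)⁻¹)` (the lift-curvature column; g23 ✓`dist1_rect_rel_lift_sq_le` road, `L⁻²` gain); `mA` — relative LIFT chords on the four
bonds of a region plaquette (parent-READ′ feedback class via ✓p832421 `norm_logVec_liftChord_le_eleven_tenths`); size classes `aU, aA` (stage ∕ lift PLAQUETTES:
θ-class — (k3)∕`hplaq`, lift curvature) and `sU, sA` (stage ∕ lift BONDS: **σ-CLASS, NOT θ-class** — architect's HAZARD «FB-σ» 22:10:33Z: they multiply the feedback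
`mA`, so their supplier must be the PER-LEVEL arc profile `σ_t` of the two gauged towers (datum guard `1∕128` at the top, decayed∕`α`-small below — a separate letter),
never the flat `¼` of ✓p835602, whose only use is the rows' `11∕10`; the (α) assembler prints the resulting `β_X` number).  No geometry, no new analysis.

WHAT IS PROVED (sorry-free).  ★★★`rhoTilde_of_regionLetters`.

HONEST SCOPE.  Group bookkeeping over a landed comparison; the seven letters are HYPOTHESES; nothing of Bałaban's renormalisation-group analysis is asserted or proved
([Balaban1985Averaging] (8)–(9) p.19, (58) p.27, Prop. 4 (128)–(135) pp.37–38; [Balaban1985RegularSpaces] (1.29) p.81 — printed conventions).  `discRow'`'s other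
letters, the (α) assembler, the columns' budgets, the SUPPLIER KNIT, GAP♯∘ (`stub_uniformFibreGapOrbit`, registry 3732b7df UNTOUCHED), the five registered stubs (0∕5),
S2β, 20520, 19936, 19200, `YM3TorusSU2` are NOT proved; no registered stub is closed; rung R3 — NOT d = 4, NOT infinite volume, NOT a mass gap, NOT Clay; the
Yang–Mills mass gap is NOT proved.
-/

set_option autoImplicit false

noncomputable section

namespace Summit.QuantumFields.YangMills.Theorems.FluctuationComparisonRegPrIntLS2BetaRhoTildeOfRegionLetters

open scoped Real
open Literature.MathematicalPhysics.QuantumLattice (su2Quat)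
open Literature.MathematicalPhysics.QuantumFieldTheory.Balaban1983to89
open T4Continuum T3ContinuumYM3Torus T3TiltDescent T3LevelShift BlockAveraging
open B10Eq27TorusAxialLog (rel axialT)
open T4CubeChartGnomonic (SU2)
open T4HaarSU2ExpChart (expPoint)
open T4ExpWindowSmallField (logVec)
open T3UnitLawDensityEML (ℰp)
open Summit.QuantumFields.YangMills.Theorems.FluctuationComparisonRegPrIntLS2BetaTildePlaquetteComparison (dist1_plaqHol_tilde_rel_le)
open Summit.QuantumFields.YangMills.Theorems.FluctuationComparisonRegPrIntLS2BetaRelativeStokes (dist1_comm_le_SU)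

/-- ★★★ **THE ρ̃ LETTER OF `discRow'` FROM REGION LETTERS.**  For the two gauged stage towers of the station (`U = g₀_s • Ū^s U₁`, `W = g_s • Ū^s(e^ζU₀)`,
`s = K − (J+(t+1))`) and their hat lifts `A_U, A_W` of the parents: from the REGION letters `ρS` (relative stage plaquettes), `ρA` (relative lift plaquettes), `mA`
(relative lift chords on the four bonds of a region plaquette) and the per-level size classes `sU, aU, sA, aA` (stage∕lift bonds and plaquettes), px20's `hρ`
binder VERBATIM at `ρt t B := ρS t B + ρA t B + 2·(4·sU t + aU t)·mA t B + 2·(4·sA t + aA t)·mA t B` — ✓p832842 `dist1_plaqHol_tilde_rel_le` per region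
plaquette, `hcomm` by ✓`dist1_comm_le_SU`. [cite: Balaban1985Averaging, (8)-(9) p.19, (58) p.27, Prop. 4 (128)-(135) pp.37-38; Balaban1985RegularSpaces, (1.29) p.81] -/
theorem rhoTilde_of_regionLetters
    {F : T3Family} {J K : ℕ} (U₀ : GaugeField (F.P K) 0 (Matrix.specialUnitaryGroup (Fin 2) ℂ)) (ζ : PBond (F.P K) 0 → EuclideanSpace ℝ (Fin 3))
    (lift : (j : ℕ) → GaugeField (F.P K) (j + 1) SU2 → GaugeField (F.P K) j SU2)
    (U₁ : GaugeField (F.P K) 0 SU2) (g g₀ : (j : ℕ) → Site (F.P K) j → SU2)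
    (sU aU sA aA : ℕ → ℝ) (hsU0 : ∀ t, 0 ≤ sU t) (hsA0 : ∀ t, 0 ≤ sA t)
    (ρS ρA mA : ℕ → PBond (F.P J) 0 → ℝ) (hmA0 : ∀ t B, 0 ≤ mA t B)
    (hsU : ∀ t, t < K - J → ∀ b : PBond (F.P K) (K - (J + (t + 1))), dist1 (GaugeField.gaugeAct (g₀ (K - (J + (t + 1)))) (Averaging.iter (fun k => blockAvg (P := F.P K) (j := k) ℰp) (K - (J + (t + 1))) U₁) b) ≤ sU t)
    (haU : ∀ t, t < K - J → ∀ q : Plaq (F.P K) (K - (J + (t + 1))), dist1 (GaugeField.plaqHol (GaugeField.gaugeAct (g₀ (K - (J + (t + 1)))) (Averaging.iter (fun k => blockAvg (P := F.P K) (j := k) ℰp) (K - (J + (t + 1))) U₁)) q) ≤ aU t)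
    (hsA : ∀ t, t < K - J → ∀ b : PBond (F.P K) (K - (J + (t + 1))), dist1 (lift (K - (J + (t + 1))) (GaugeField.gaugeAct (g₀ ((K - (J + (t + 1))) + 1)) (Averaging.iter (fun k => blockAvg (P := F.P K) (j := k) ℰp) ((K - (J + (t + 1))) + 1) U₁)) b) ≤ sA t)
    (haA : ∀ t, t < K - J → ∀ q : Plaq (F.P K) (K - (J + (t + 1))), dist1 (GaugeField.plaqHol (lift (K - (J + (t + 1))) (GaugeField.gaugeAct (g₀ ((K - (J + (t + 1))) + 1)) (Averaging.iter (fun k => blockAvg (P := F.P K) (j := k) ℰp) ((K - (J + (t + 1))) + 1) U₁))) q) ≤ aA t)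
    (hρS : ∀ (t : ℕ) (ht : t < K - J) (B : PBond (F.P J) 0) (q : Plaq (F.P K) (K - (J + (t + 1)))),
      (∃ ℓ' : PBond (F.P (J + (t + 1))) 0, (∃ z : Site (F.P (J + (t + 1))) 0,
                (B14.Eq22Determines.blockIter (t + 1) z = (bondShift (F.sitesPerDir_eq (m := F.m) (K := J) (j := 0) (m' := F.m) (K' := J + (t + 1)) (j' := t + 1) (by omega)) B).src ∨ B14.Eq22Determines.blockIter (t + 1) z = (bondShift (F.sitesPerDir_eq (m := F.m) (K := J) (j := 0) (m' := F.m) (K' := J + (t + 1)) (j' := t + 1) (by omega)) B).tgt) ∧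
                ∀ ν, (B10Eq27TorusAxialLog.rel z ℓ'.src ν).natAbs ≤ 2) ∧
        (blockOf q.src = blockOf (bondShift (F.sitesPerDir_eq (m := F.m) (K := J + (t + 1)) (j := 0) (m' := F.m) (K' := K) (j' := (K - (J + (t + 1)))) (by omega)) ℓ').src ∨ blockOf q.src = (blockOf (bondShift (F.sitesPerDir_eq (m := F.m) (K := J + (t + 1)) (j := 0) (m' := F.m) (K' := K) (j' := (K - (J + (t + 1)))) (by omega)) ℓ').src).shift (bondShift (F.sitesPerDir_eq (m := F.m) (K := J + (t + 1)) (j := 0) (m' := F.m) (K' := K) (j' := (K - (J + (t + 1)))) (by omega)) ℓ').dir)) →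
      dist1 ((GaugeField.plaqHol (GaugeField.gaugeAct (g₀ (K - (J + (t + 1)))) (Averaging.iter (fun k => blockAvg (P := F.P K) (j := k) ℰp) (K - (J + (t + 1))) U₁)) q)⁻¹ * GaugeField.plaqHol (GaugeField.gaugeAct (g (K - (J + (t + 1)))) (Averaging.iter (fun k => blockAvg (P := F.P K) (j := k) ℰp) (K - (J + (t + 1))) (fun ℓ => expPoint (ζ ℓ) * U₀ ℓ))) q) ≤ ρS t B)
    (hρA : ∀ (t : ℕ) (ht : t < K - J) (B : PBond (F.P J) 0) (q : Plaq (F.P K) (K - (J + (t + 1)))),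
      (∃ ℓ' : PBond (F.P (J + (t + 1))) 0, (∃ z : Site (F.P (J + (t + 1))) 0,
                (B14.Eq22Determines.blockIter (t + 1) z = (bondShift (F.sitesPerDir_eq (m := F.m) (K := J) (j := 0) (m' := F.m) (K' := J + (t + 1)) (j' := t + 1) (by omega)) B).src ∨ B14.Eq22Determines.blockIter (t + 1) z = (bondShift (F.sitesPerDir_eq (m := F.m) (K := J) (j := 0) (m' := F.m) (K' := J + (t + 1)) (j' := t + 1) (by omega)) B).tgt) ∧
                ∀ ν, (B10Eq27TorusAxialLog.rel z ℓ'.src ν).natAbs ≤ 2) ∧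
        (blockOf q.src = blockOf (bondShift (F.sitesPerDir_eq (m := F.m) (K := J + (t + 1)) (j := 0) (m' := F.m) (K' := K) (j' := (K - (J + (t + 1)))) (by omega)) ℓ').src ∨ blockOf q.src = (blockOf (bondShift (F.sitesPerDir_eq (m := F.m) (K := J + (t + 1)) (j := 0) (m' := F.m) (K' := K) (j' := (K - (J + (t + 1)))) (by omega)) ℓ').src).shift (bondShift (F.sitesPerDir_eq (m := F.m) (K := J + (t + 1)) (j := 0) (m' := F.m) (K' := K) (j' := (K - (J + (t + 1)))) (by omega)) ℓ').dir)) →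
      dist1 (GaugeField.plaqHol (lift (K - (J + (t + 1))) (GaugeField.gaugeAct (g ((K - (J + (t + 1))) + 1)) (Averaging.iter (fun k => blockAvg (P := F.P K) (j := k) ℰp) ((K - (J + (t + 1))) + 1) (fun ℓ => expPoint (ζ ℓ) * U₀ ℓ)))) q * (GaugeField.plaqHol (lift (K - (J + (t + 1))) (GaugeField.gaugeAct (g₀ ((K - (J + (t + 1))) + 1)) (Averaging.iter (fun k => blockAvg (P := F.P K) (j := k) ℰp) ((K - (J + (t + 1))) + 1) U₁))) q)⁻¹) ≤ ρA t B)
    (hmA : ∀ (t : ℕ) (ht : t < K - J) (B : PBond (F.P J) 0) (q : Plaq (F.P K) (K - (J + (t + 1)))),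
      (∃ ℓ' : PBond (F.P (J + (t + 1))) 0, (∃ z : Site (F.P (J + (t + 1))) 0,
                (B14.Eq22Determines.blockIter (t + 1) z = (bondShift (F.sitesPerDir_eq (m := F.m) (K := J) (j := 0) (m' := F.m) (K' := J + (t + 1)) (j' := t + 1) (by omega)) B).src ∨ B14.Eq22Determines.blockIter (t + 1) z = (bondShift (F.sitesPerDir_eq (m := F.m) (K := J) (j := 0) (m' := F.m) (K' := J + (t + 1)) (j' := t + 1) (by omega)) B).tgt) ∧
                ∀ ν, (B10Eq27TorusAxialLog.rel z ℓ'.src ν).natAbs ≤ 2) ∧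
        (blockOf q.src = blockOf (bondShift (F.sitesPerDir_eq (m := F.m) (K := J + (t + 1)) (j := 0) (m' := F.m) (K' := K) (j' := (K - (J + (t + 1)))) (by omega)) ℓ').src ∨ blockOf q.src = (blockOf (bondShift (F.sitesPerDir_eq (m := F.m) (K := J + (t + 1)) (j := 0) (m' := F.m) (K' := K) (j' := (K - (J + (t + 1)))) (by omega)) ℓ').src).shift (bondShift (F.sitesPerDir_eq (m := F.m) (K := J + (t + 1)) (j := 0) (m' := F.m) (K' := K) (j' := (K - (J + (t + 1)))) (by omega)) ℓ').dir)) →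
      ∀ b : PBond (F.P K) (K - (J + (t + 1))), b = ⟨q.src, q.μ⟩ ∨ b = ⟨q.src.shift q.μ, q.ν⟩ ∨ b = ⟨q.src.shift q.ν, q.μ⟩ ∨ b = ⟨q.src, q.ν⟩ →
        dist1 ((lift (K - (J + (t + 1))) (GaugeField.gaugeAct (g₀ ((K - (J + (t + 1))) + 1)) (Averaging.iter (fun k => blockAvg (P := F.P K) (j := k) ℰp) ((K - (J + (t + 1))) + 1) U₁)) b)⁻¹ * lift (K - (J + (t + 1))) (GaugeField.gaugeAct (g ((K - (J + (t + 1))) + 1)) (Averaging.iter (fun k => blockAvg (P := F.P K) (j := k) ℰp) ((K - (J + (t + 1))) + 1) (fun ℓ => expPoint (ζ ℓ) * U₀ ℓ))) b) ≤ mA t B) :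
    ∀ (t : ℕ) (ht : t < K - J) (B : PBond (F.P J) 0) (q : Plaq (F.P K) (K - (J + (t + 1)))),
      (∃ ℓ' : PBond (F.P (J + (t + 1))) 0, (∃ z : Site (F.P (J + (t + 1))) 0,
                (B14.Eq22Determines.blockIter (t + 1) z = (bondShift (F.sitesPerDir_eq (m := F.m) (K := J) (j := 0) (m' := F.m) (K' := J + (t + 1)) (j' := t + 1) (by omega)) B).src ∨ B14.Eq22Determines.blockIter (t + 1) z = (bondShift (F.sitesPerDir_eq (m := F.m) (K := J) (j := 0) (m' := F.m) (K' := J + (t + 1)) (j' := t + 1) (by omega)) B).tgt) ∧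
                ∀ ν, (B10Eq27TorusAxialLog.rel z ℓ'.src ν).natAbs ≤ 2) ∧
        (blockOf q.src = blockOf (bondShift (F.sitesPerDir_eq (m := F.m) (K := J + (t + 1)) (j := 0) (m' := F.m) (K' := K) (j' := (K - (J + (t + 1)))) (by omega)) ℓ').src ∨ blockOf q.src = (blockOf (bondShift (F.sitesPerDir_eq (m := F.m) (K := J + (t + 1)) (j := 0) (m' := F.m) (K' := K) (j' := (K - (J + (t + 1)))) (by omega)) ℓ').src).shift (bondShift (F.sitesPerDir_eq (m := F.m) (K := J + (t + 1)) (j := 0) (m' := F.m) (K' := K) (j' := (K - (J + (t + 1)))) (by omega)) ℓ').dir)) →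
      dist1 ((GaugeField.plaqHol (fun b => lift (K - (J + (t + 1))) (GaugeField.gaugeAct (g ((K - (J + (t + 1))) + 1)) (Averaging.iter (fun k => blockAvg (P := F.P K) (j := k) ℰp) ((K - (J + (t + 1))) + 1) (fun ℓ => expPoint (ζ ℓ) * U₀ ℓ))) b *
            (lift (K - (J + (t + 1))) (GaugeField.gaugeAct (g₀ ((K - (J + (t + 1))) + 1)) (Averaging.iter (fun k => blockAvg (P := F.P K) (j := k) ℰp) ((K - (J + (t + 1))) + 1) U₁)) b)⁻¹ *
          (GaugeField.gaugeAct (g₀ (K - (J + (t + 1)))) (Averaging.iter (fun k => blockAvg (P := F.P K) (j := k) ℰp) (K - (J + (t + 1))) U₁)) b : GaugeField (F.P K) (K - (J + (t + 1))) SU2) q)⁻¹ *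
        GaugeField.plaqHol (GaugeField.gaugeAct (g (K - (J + (t + 1)))) (Averaging.iter (fun k => blockAvg (P := F.P K) (j := k) ℰp) (K - (J + (t + 1))) (fun ℓ => expPoint (ζ ℓ) * U₀ ℓ))) q) ≤
        ρS t B + ρA t B + 2 * (4 * sU t + aU t) * mA t B + 2 * (4 * sA t + aA t) * mA t B := by
  intro t ht B q hq
  have hcomm : ∀ a b : SU2, dist1 (a * b * a⁻¹ * b⁻¹) ≤ 2 * dist1 a * dist1 b := fun a b => dist1_comm_le_SU a b
  -- px20's `W̃` is written left-associated `A_W b * (A_U b)⁻¹ * U b`; ✓p832842's is `A_W b * ((A_U b)⁻¹ * U b)`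
  have e3 : (fun b => lift (K - (J + (t + 1))) (GaugeField.gaugeAct (g ((K - (J + (t + 1))) + 1)) (Averaging.iter (fun k => blockAvg (P := F.P K) (j := k) ℰp) ((K - (J + (t + 1))) + 1) (fun ℓ => expPoint (ζ ℓ) * U₀ ℓ))) b *
            (lift (K - (J + (t + 1))) (GaugeField.gaugeAct (g₀ ((K - (J + (t + 1))) + 1)) (Averaging.iter (fun k => blockAvg (P := F.P K) (j := k) ℰp) ((K - (J + (t + 1))) + 1) U₁)) b)⁻¹ *
          GaugeField.gaugeAct (g₀ (K - (J + (t + 1)))) (Averaging.iter (fun k => blockAvg (P := F.P K) (j := k) ℰp) (K - (J + (t + 1))) U₁) b : GaugeField (F.P K) (K - (J + (t + 1))) SU2) =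
      fun b => lift (K - (J + (t + 1))) (GaugeField.gaugeAct (g ((K - (J + (t + 1))) + 1)) (Averaging.iter (fun k => blockAvg (P := F.P K) (j := k) ℰp) ((K - (J + (t + 1))) + 1) (fun ℓ => expPoint (ζ ℓ) * U₀ ℓ))) b * ((lift (K - (J + (t + 1))) (GaugeField.gaugeAct (g₀ ((K - (J + (t + 1))) + 1)) (Averaging.iter (fun k => blockAvg (P := F.P K) (j := k) ℰp) ((K - (J + (t + 1))) + 1) U₁)) b)⁻¹ * GaugeField.gaugeAct (g₀ (K - (J + (t + 1)))) (Averaging.iter (fun k => blockAvg (P := F.P K) (j := k) ℰp) (K - (J + (t + 1))) U₁) b) :=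
    funext fun b => mul_assoc _ _ _
  rw [e3]
  have key := dist1_plaqHol_tilde_rel_le hcomm (GaugeField.gaugeAct (g₀ (K - (J + (t + 1)))) (Averaging.iter (fun k => blockAvg (P := F.P K) (j := k) ℰp) (K - (J + (t + 1))) U₁)) (GaugeField.gaugeAct (g (K - (J + (t + 1)))) (Averaging.iter (fun k => blockAvg (P := F.P K) (j := k) ℰp) (K - (J + (t + 1))) (fun ℓ => expPoint (ζ ℓ) * U₀ ℓ))) (lift (K - (J + (t + 1))) (GaugeField.gaugeAct (g₀ ((K - (J + (t + 1))) + 1)) (Averaging.iter (fun k => blockAvg (P := F.P K) (j := k) ℰp) ((K - (J + (t + 1))) + 1) U₁))) (lift (K - (J + (t + 1))) (GaugeField.gaugeAct (g ((K - (J + (t + 1))) + 1)) (Averaging.iter (fun k => blockAvg (P := F.P K) (j := k) ℰp) ((K - (J + (t + 1))) + 1) (fun ℓ => expPoint (ζ ℓ) * U₀ ℓ)))) q (hsU0 t) (hsA0 t) (hmA0 t B)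
    (fun b _ => hsU t ht b) (fun b _ => hsA t ht b) (fun b hb => hmA t ht B q hq b hb) (haU t ht q) (haA t ht q)
  exact key.trans (add_le_add (add_le_add (add_le_add (hρS t ht B q hq) (hρA t ht B q hq)) le_rfl) le_rfl)

end Summit.QuantumFields.YangMills.Theorems.FluctuationComparisonRegPrIntLS2BetaRhoTildeOfRegionLetters

end
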